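import Literature.Probability.RandomPlanarGeometry.KPRecurrenceDecay
import Mathlib.Analysis.SpecialFunctions.Pow.Real
import Mathlib.Analysis.Complex.ExponentialBounds
import HarnessLib

/-!
# Crux `HexConjecture` (stmt-CriticalPhenomena-0808), line `root-locality-replaces-loewner`:
the analytic step of Krachun–Panagiotis with an EXPLICIT exponent, for the tree's two-case recurrence

Landing target:
`Summits/CriticalPhenomena/SAWScalingLimit/Theorems/SAWDevelopingMapHexConjectureKPExplicitDecay.lean`
(`--supports stmt-CriticalPhenomena-0808`; lane pcv-sawmu, seat a-p4).

The line proved KP's Theorem 2 with an unspecified exponent (`…KPTheorem2.lean`, via Corollary 3.1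
with `∃ C_big` and Lemma 3.4 with `ε = 1/(100B)`).  This file is the abstract real-sequence theorem
that makes the exponent explicit for the line's two-case recurrence (`stub_kp_dichotomy` with the
caps of `cor31_renCap_le`, `c₁ = 128cos(π/8)`, and the window tail `stub_kp_windowTail`):
**`decay_of_dichotomy`** — `a_T ≤ 100·a₀·T^{-ε}` for every `J ≥ 1`, `ε > 0` with
`5ε·log(144·22^{J-1}) ≤ 1`, `10e·(1/a₀+c₁)²κβ²/c_b ≤ J`, `2e·(1/a₀+c₁)κβ/c_a ≤ J` (`β = 1/(1-ε)+1/100`).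
Proof: KP's Lemma 3.4 as a strong induction on `T`, with a three-way split at the pigeonholed scale
`t` (`a(2t) < a((t/2-1)/2)/q`, `a(5t) < a(t-1)/q`, or both cap ratios `≤ q = (144·22^{J-1})^ε`),
which bounds the caps without a lower bound on `a`.  Instantiation: `…KPExplicitExponent.lean`.
Sources: Krachun–Panagiotis, arXiv:2310.17299 (Ann. Probab. 2026), Lemma 3.4 and §3.2.
-/

noncomputable section

open Real Finset

namespace Summit.CriticalPhenomena.SAWScalingLimit.Theorems.HexConjecture.RootLocality.KPExplicit

/-- `exp(1/5) < 100`. [folklore] -/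
theorem exp_one_fifth_lt : Real.exp (1 / 5) < 100 := by
  have h1 : Real.exp (1 / 5) ≤ Real.exp 1 := Real.exp_le_exp.2 (by norm_num)
  have h2 := Real.exp_one_lt_d9
  norm_num at h2
  linarith

/-- `1 ≤ log 144`. [folklore] -/
theorem one_le_log_144 : (1 : ℝ) ≤ Real.log 144 := by
  rw [Real.le_log_iff_exp_le (by norm_num)]
  have := Real.exp_one_lt_d9
  norm_num at this
  linarith

/-- The cap bound: `1 + c₁·a_m·S/a₂ ≤ q·C₁·B` when `a_m/a₂ ≤ q`, `1 ≤ S/a₀`, `S ≤ B`, `q ≥ 1`,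
`C₁ = 1/a₀ + c₁`. [cite: KrachunPanagiotis2026, §3.2 (M_k; proof of Corollary 3.1)] -/
theorem cap_alg {c₁ am a₂ S a₀ q C₁ B : ℝ} (hc₁ : 0 ≤ c₁) (ha₂ : 0 < a₂) (ha₀ : 0 < a₀)
    (hS : 0 < S) (hq1 : 1 ≤ q) (hC₁ : C₁ = 1 / a₀ + c₁) (hr : am / a₂ ≤ q) (hone : 1 ≤ S / a₀)
    (hSB : S ≤ B) : 1 + c₁ * am * S / a₂ ≤ q * C₁ * B := by
  have hq0 : 0 ≤ q := by linarith
  have hC₁0 : 0 ≤ C₁ := by rw [hC₁]; positivity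
  have e1 : 1 + c₁ * am * S / a₂ = 1 + c₁ * (am / a₂) * S := by field_simp
  rw [e1]
  have h1 : c₁ * (am / a₂) * S ≤ c₁ * q * S :=
    mul_le_mul_of_nonneg_right (mul_le_mul_of_nonneg_left hr hc₁) hS.le
  have h2 : (1 : ℝ) ≤ q * (S / a₀) := one_le_mul_of_one_le_of_one_le hq1 hone
  calc 1 + c₁ * (am / a₂) * S ≤ q * (S / a₀) + c₁ * q * S := add_le_add h2 h1
    _ = q * C₁ * S := by rw [hC₁]; ring
    _ ≤ q * C₁ * B := mul_le_mul_of_nonneg_left hSB (by positivity)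

/-- The algebra of case (a). [cite: KrachunPanagiotis2026, Lemma 3.2 and proof of Lemma 3.4 (constants ours)] -/
theorem caseA_alg {ca t a₂ a₅ aT F₁ W q C₁ A β u₀ u κ J : ℝ}
    (hca : 0 < ca) (ht : 0 < t) (haT : 0 < aT) (ha₂ : 0 < a₂) (hT2 : aT ≤ a₂) (hT5 : aT ≤ a₅)
    (hW0 : 0 ≤ W) (hA : 0 < A) (hu₀ : 0 < u₀) (hu : 0 < u) (hq : 0 < q) (hC₁ : 0 < C₁)
    (hβ : 0 < β) (hκ : 0 < κ) (hJ : 0 < J)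
    (hF₁ : F₁ ≤ q * C₁ * (A * β * (2 * t * u₀))) (hWle : W ≤ κ * (A * u₀) / J)
    (hu₀q : u₀ ≤ q * u) (hcoef : 2 * C₁ * κ * β * q ^ 3 / (ca * J) ≤ 1)
    (h : ca * t * a₂ * a₅ ≤ F₁ * W) : aT ≤ A * u := by
  have hAu : 0 ≤ A * u := by positivity
  have step1 : ca * t * a₂ * a₅ ≤ (q * C₁ * (A * β * (2 * t * u₀))) * (κ * (A * u₀) / J) :=
    h.trans (mul_le_mul hF₁ hWle hW0 (by positivity))
  have step2 : a₂ * a₅ ≤ (2 * C₁ * κ * β * q / (ca * J)) * (A ^ 2 * u₀ ^ 2) := by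
    have hct : 0 < ca * t := mul_pos hca ht
    have : ca * t * (a₂ * a₅) ≤ ca * t * ((2 * C₁ * κ * β * q / (ca * J)) * (A ^ 2 * u₀ ^ 2)) := by
      calc ca * t * (a₂ * a₅) = ca * t * a₂ * a₅ := by ring
        _ ≤ (q * C₁ * (A * β * (2 * t * u₀))) * (κ * (A * u₀) / J) := step1
        _ = ca * t * ((2 * C₁ * κ * β * q / (ca * J)) * (A ^ 2 * u₀ ^ 2)) := by
            field_simp
    exact le_of_mul_le_mul_left this hct
  have hu₀2 : u₀ ^ 2 ≤ q ^ 2 * u ^ 2 := by rw [← mul_pow]; exact pow_le_pow_left₀ hu₀.le hu₀q 2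
  have step3 : aT ^ 2 ≤ (2 * C₁ * κ * β * q ^ 3 / (ca * J)) * (A * u) ^ 2 := by
    calc aT ^ 2 = aT * aT := sq _
      _ ≤ a₂ * a₅ := mul_le_mul hT2 hT5 haT.le ha₂.le
      _ ≤ (2 * C₁ * κ * β * q / (ca * J)) * (A ^ 2 * u₀ ^ 2) := step2
      _ ≤ (2 * C₁ * κ * β * q / (ca * J)) * (A ^ 2 * (q ^ 2 * u ^ 2)) := by
          apply mul_le_mul_of_nonneg_left _ (by positivity)
          exact mul_le_mul_of_nonneg_left hu₀2 (by positivity)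
      _ = (2 * C₁ * κ * β * q ^ 3 / (ca * J)) * (A * u) ^ 2 := by ring
  have step4 : aT ^ 2 ≤ (A * u) ^ 2 := by
    refine step3.trans ?_
    calc (2 * C₁ * κ * β * q ^ 3 / (ca * J)) * (A * u) ^ 2 ≤ 1 * (A * u) ^ 2 :=
          mul_le_mul_of_nonneg_right hcoef (pow_nonneg hAu 2)
      _ = (A * u) ^ 2 := one_mul _
  exact le_of_pow_le_pow_left₀ (by norm_num) hAu step4

/-- The algebra of case (b). [cite: KrachunPanagiotis2026, Lemma 3.3 and proof of Lemma 3.4 (constants ours)] -/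
theorem caseB_alg {cb t a₂ a₅ a₉ aT F₁ F₂ W q C₁ A β u₀ u κ J : ℝ}
    (hcb : 0 < cb) (ht : 0 < t) (haT : 0 < aT) (ha₂ : 0 < a₂) (ha₅ : 0 < a₅) (hT2 : aT ≤ a₂)
    (hT5 : aT ≤ a₅) (hT9 : aT ≤ a₉) (hW0 : 0 ≤ W) (hF₂0 : 0 ≤ F₂) (hA : 0 < A) (hu₀ : 0 < u₀)
    (hu : 0 < u) (hq : 0 < q) (hC₁ : 0 < C₁) (hβ : 0 < β) (hκ : 0 < κ) (hJ : 0 < J)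
    (hF₁ : F₁ ≤ q * C₁ * (A * β * (2 * t * u₀))) (hF₂ : F₂ ≤ q * C₁ * (A * β * (5 * t * u₀)))
    (hWle : W ≤ κ * (A * u₀) / J) (hu₀q : u₀ ≤ q * u)
    (hcoef : 10 * C₁ ^ 2 * κ * β ^ 2 * q ^ 5 / (cb * J) ≤ 1)
    (h : cb * t ^ 2 * a₂ * a₅ * a₉ ≤ F₁ * F₂ * W) : aT ≤ A * u := by
  have hAu : 0 ≤ A * u := by positivity
  have step1 : cb * t ^ 2 * a₂ * a₅ * a₉ ≤
      ((q * C₁ * (A * β * (2 * t * u₀))) * (q * C₁ * (A * β * (5 * t * u₀)))) *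
        (κ * (A * u₀) / J) :=
    h.trans (mul_le_mul (mul_le_mul hF₁ hF₂ hF₂0 (by positivity)) hWle hW0 (by positivity))
  have step2 : a₂ * a₅ * a₉ ≤ (10 * C₁ ^ 2 * κ * β ^ 2 * q ^ 2 / (cb * J)) * (A ^ 3 * u₀ ^ 3) := by
    have hct : 0 < cb * t ^ 2 := by positivity
    have : cb * t ^ 2 * (a₂ * a₅ * a₉) ≤
        cb * t ^ 2 * ((10 * C₁ ^ 2 * κ * β ^ 2 * q ^ 2 / (cb * J)) * (A ^ 3 * u₀ ^ 3)) := by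
      calc cb * t ^ 2 * (a₂ * a₅ * a₉) = cb * t ^ 2 * a₂ * a₅ * a₉ := by ring
        _ ≤ _ := step1
        _ = cb * t ^ 2 * ((10 * C₁ ^ 2 * κ * β ^ 2 * q ^ 2 / (cb * J)) * (A ^ 3 * u₀ ^ 3)) := by
            field_simp
            ring
    exact le_of_mul_le_mul_left this hct
  have hu₀3 : u₀ ^ 3 ≤ q ^ 3 * u ^ 3 := by rw [← mul_pow]; exact pow_le_pow_left₀ hu₀.le hu₀q 3
  have haT3 : aT ^ 3 ≤ a₂ * a₅ * a₉ := by
    calc aT ^ 3 = aT * aT * aT := by ring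
      _ ≤ a₂ * a₅ * a₉ :=
          mul_le_mul (mul_le_mul hT2 hT5 haT.le ha₂.le) hT9 haT.le (by positivity)
  have step3 : aT ^ 3 ≤ (10 * C₁ ^ 2 * κ * β ^ 2 * q ^ 5 / (cb * J)) * (A * u) ^ 3 := by
    calc aT ^ 3 ≤ a₂ * a₅ * a₉ := haT3
      _ ≤ (10 * C₁ ^ 2 * κ * β ^ 2 * q ^ 2 / (cb * J)) * (A ^ 3 * u₀ ^ 3) := step2
      _ ≤ (10 * C₁ ^ 2 * κ * β ^ 2 * q ^ 2 / (cb * J)) * (A ^ 3 * (q ^ 3 * u ^ 3)) := by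
          apply mul_le_mul_of_nonneg_left _ (by positivity)
          exact mul_le_mul_of_nonneg_left hu₀3 (by positivity)
      _ = (10 * C₁ ^ 2 * κ * β ^ 2 * q ^ 5 / (cb * J)) * (A * u) ^ 3 := by ring
  have step4 : aT ^ 3 ≤ (A * u) ^ 3 := by
    refine step3.trans ?_
    calc (10 * C₁ ^ 2 * κ * β ^ 2 * q ^ 5 / (cb * J)) * (A * u) ^ 3 ≤ 1 * (A * u) ^ 3 :=
          mul_le_mul_of_nonneg_right hcoef (pow_nonneg hAu 3)
      _ = (A * u) ^ 3 := one_mul _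
  exact le_of_pow_le_pow_left₀ (by norm_num) hAu step4

set_option maxHeartbeats 400000 in
/-- **Two-case recurrence with monotone caps + window tail ⇒ polynomial decay with an explicit
exponent.** See the module docstring. [cite: KrachunPanagiotis2026, Lemma 3.4 and Corollary 3.1 (proof strategy; constants ours)] -/
theorem decay_of_dichotomy {a W : ℕ → ℝ} {c₁ ca cb κ ε : ℝ} {J : ℕ}
    (ha : ∀ k, 0 < a k) (hanti : Antitone a) (hW : ∀ T, 0 ≤ W T)
    (hc₁ : 0 ≤ c₁) (hca : 0 < ca) (hcb : 0 < cb) (hκ : 0 < κ)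
    (htail : ∀ T₀ : ℕ, 1 ≤ T₀ → ∀ B : ℕ, ∑ j ∈ range B, W (22 ^ j * T₀) ≤ κ * a (T₀ - 1))
    (hdich : ∀ t : ℕ, 1 ≤ t →
      ca * (t : ℝ) * a (2 * t) * a (5 * t) ≤
          (1 + c₁ * a ((t / 2 - 1) / 2) * (∑ i ∈ range (2 * t + 1), a i) / a (2 * t)) * W t ∨
        cb * (t : ℝ) ^ 2 * a (2 * t) * a (5 * t) * a (9 * t) ≤
          (1 + c₁ * a ((t / 2 - 1) / 2) * (∑ i ∈ range (2 * t + 1), a i) / a (2 * t)) *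
            (1 + c₁ * a (t - 1) * (∑ i ∈ range (5 * t + 1), a i) / a (5 * t)) * W t)
    (hJ1 : 1 ≤ J) (hε : 0 < ε) (hεM : ε * (5 * Real.log (144 * 22 ^ (J - 1))) ≤ 1)
    (hJB : 10 * Real.exp 1 * (1 / a 0 + c₁) ^ 2 * κ * (1 / (1 - ε) + 1 / 100) ^ 2 / cb ≤ J)
    (hJA : 2 * Real.exp 1 * (1 / a 0 + c₁) * κ * (1 / (1 - ε) + 1 / 100) / ca ≤ J) :
    ∀ T : ℕ, 1 ≤ T → a T ≤ 100 * a 0 * (T : ℝ) ^ (-ε) := by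
  -- constants
  have ha0 := ha 0
  set M : ℕ := 9 * 22 ^ (J - 1) with hM
  have hMpos : 0 < M := by rw [hM]; positivity
  set R : ℝ := 144 * 22 ^ (J - 1) with hR
  have hRM : R = 16 * (M : ℝ) := by rw [hR, hM]; push_cast; ring
  have hR144 : 144 ≤ R := by rw [hR]; nlinarith [one_le_pow₀ (M₀ := ℝ) (a := 22) (by norm_num) (n := J - 1)]
  have hRpos : 0 < R := by linarith
  have hlogR : 1 ≤ Real.log R := one_le_log_144.trans (Real.log_le_log (by norm_num) hR144)
  have hε5 : ε ≤ 1 / 5 := by rw [le_div_iff₀ (by norm_num : (0:ℝ) < 5)]; nlinarith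
  have h1ε : 0 < 1 - ε := by linarith
  set A : ℝ := 100 * a 0 with hA
  have hApos : 0 < A := by rw [hA]; exact mul_pos (by norm_num) ha0
  set β : ℝ := 1 / (1 - ε) + 1 / 100 with hβ
  have hβpos : 0 < β := by rw [hβ]; positivity
  set C₁ : ℝ := 1 / a 0 + c₁ with hC₁
  have hC₁pos : 0 < C₁ := by rw [hC₁]; positivity
  set q : ℝ := R ^ ε with hq
  have hqpos : 0 < q := Real.rpow_pos_of_pos hRpos ε
  have hq1 : 1 ≤ q := Real.one_le_rpow (by linarith) hε.le
  have hq5 : q ^ 5 ≤ Real.exp 1 := by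
    rw [hq, ← Real.rpow_natCast, ← Real.rpow_mul hRpos.le, Real.rpow_def_of_pos hRpos]
    exact Real.exp_le_exp.2 (by push_cast; nlinarith)
  have hq3 : q ^ 3 ≤ Real.exp 1 := (pow_le_pow_right₀ hq1 (by norm_num : 3 ≤ 5)).trans hq5
  have hJpos : (0 : ℝ) < J := by exact_mod_cast hJ1
  have hcoefB : 10 * C₁ ^ 2 * κ * β ^ 2 * q ^ 5 / (cb * J) ≤ 1 := by
    rw [div_le_one (by positivity)]
    calc 10 * C₁ ^ 2 * κ * β ^ 2 * q ^ 5
        ≤ 10 * C₁ ^ 2 * κ * β ^ 2 * Real.exp 1 := mul_le_mul_of_nonneg_left hq5 (by positivity)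
      _ = (10 * Real.exp 1 * (1 / a 0 + c₁) ^ 2 * κ * (1 / (1 - ε) + 1 / 100) ^ 2 / cb) * cb := by
          rw [hC₁, hβ]; field_simp
      _ ≤ J * cb := mul_le_mul_of_nonneg_right hJB hcb.le
      _ = cb * J := mul_comm _ _
  have hcoefA : 2 * C₁ * κ * β * q ^ 3 / (ca * J) ≤ 1 := by
    rw [div_le_one (by positivity)]
    calc 2 * C₁ * κ * β * q ^ 3 ≤ 2 * C₁ * κ * β * Real.exp 1 := mul_le_mul_of_nonneg_left hq3 (by positivity)
      _ = (2 * Real.exp 1 * (1 / a 0 + c₁) * κ * (1 / (1 - ε) + 1 / 100) / ca) * ca := by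
          rw [hC₁, hβ]; field_simp
      _ ≤ J * ca := mul_le_mul_of_nonneg_right hJA hca.le
      _ = ca * J := mul_comm _ _
  intro T
  induction T using Nat.strong_induction_on with
  | _ T ih =>
  intro hT
  have hTpos : (0 : ℝ) < T := by exact_mod_cast hT
  have IH : ∀ k : ℕ, 1 ≤ k → k < T → a k ≤ A * (k : ℝ) ^ (-ε) := fun k hk hkT => ih k hkT hk
  by_cases hsmall : (T : ℝ) ^ ε ≤ 100
  · have hp : 0 < (T : ℝ) ^ ε := Real.rpow_pos_of_pos hTpos ε
    have h1 : 1 ≤ 100 * (T : ℝ) ^ (-ε) := by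
      rw [Real.rpow_neg hTpos.le, ← div_eq_mul_inv, le_div_iff₀ hp]; linarith
    calc a T ≤ a 0 := hanti (Nat.zero_le T)
      _ = a 0 * 1 := (mul_one _).symm
      _ ≤ a 0 * (100 * (T : ℝ) ^ (-ε)) := mul_le_mul_of_nonneg_left h1 ha0.le
      _ = 100 * a 0 * (T : ℝ) ^ (-ε) := by ring
  push Not at hsmall
  have hTR : R < T := by
    by_contra hle
    push Not at hle
    have h1 : (T : ℝ) ^ ε ≤ R ^ ε := Real.rpow_le_rpow hTpos.le hle hε.le
    have h2 : R ^ ε ≤ Real.exp (1 / 5) := by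
      rw [Real.rpow_def_of_pos hRpos]; exact Real.exp_le_exp.2 (by nlinarith)
    linarith [exp_one_fifth_lt]
  have h16MT : 16 * M < T := by exact_mod_cast (show (16 * M : ℝ) < T by rw [← hRM]; exact hTR)
  set T₀ : ℕ := T / M with hT₀
  have hT₀16 : 16 ≤ T₀ := by rw [hT₀, Nat.le_div_iff_mul_le hMpos]; omega
  have hMT₀ : M * T₀ ≤ T := by rw [hT₀]; exact Nat.mul_div_le T M
  have hTlt : T < M * T₀ + M := by
    have h1 := Nat.div_add_mod T M; have h2 := Nat.mod_lt T hMpos; rw [hT₀]; omega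
  have hT₀T : T₀ < T := by rw [hT₀]; exact Nat.div_lt_self (by omega) (by omega)
  have hT₀pos : (0 : ℝ) < T₀ := by exact_mod_cast (show 0 < T₀ by omega)
  have hT2M : (T : ℝ) ≤ R * ((T₀ : ℝ) / 8) := by
    rw [hRM]
    have : (T : ℝ) ≤ (M : ℝ) * T₀ + M := by exact_mod_cast hTlt.le
    have hT₀1 : (1 : ℝ) ≤ T₀ := by exact_mod_cast (show 1 ≤ T₀ by omega)
    have hM0 : (0 : ℝ) ≤ M := by positivity
    nlinarith
  set u : ℝ := (T : ℝ) ^ (-ε) with hu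
  set u₀ : ℝ := ((T₀ : ℝ) / 8) ^ (-ε) with hu₀
  have hupos : 0 < u := Real.rpow_pos_of_pos hTpos _
  have hu₀pos : 0 < u₀ := Real.rpow_pos_of_pos (by positivity) _
  have hu₀ : u₀ ≤ q * u := by
    have h1 : (R * ((T₀ : ℝ) / 8)) ^ (-ε) ≤ u := Real.rpow_le_rpow_of_nonpos hTpos hT2M (by linarith)
    rw [Real.mul_rpow hRpos.le (by positivity)] at h1
    have hqlam : q * R ^ (-ε) = 1 := by rw [Real.rpow_neg hRpos.le, hq, mul_inv_cancel₀ hqpos.ne']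
    calc u₀ = q * (R ^ (-ε) * u₀) := by rw [← mul_assoc, hqlam, one_mul]
      _ ≤ q * u := mul_le_mul_of_nonneg_left h1 hqpos.le
  have hu₀qu : u₀ / q ≤ u := by rw [div_le_iff₀ hqpos, mul_comm]; exact hu₀
  have hcmp : ∀ x : ℝ, (T₀ : ℝ) / 8 ≤ x → x ^ (-ε) ≤ u₀ := fun x hx =>
    Real.rpow_le_rpow_of_nonpos (by positivity) hx (by linarith)
  obtain ⟨j, hjJ, hWj⟩ : ∃ j ∈ range J, W (22 ^ j * T₀) ≤ κ * a (T₀ - 1) / J := by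
    apply exists_le_of_sum_le (nonempty_range_iff.2 (by omega))
    rw [sum_const, card_range, nsmul_eq_mul, mul_div_cancel₀ _ hJpos.ne']
    exact htail T₀ (by omega) J
  rw [mem_range] at hjJ
  set t : ℕ := 22 ^ j * T₀ with ht
  have hT₀t : T₀ ≤ t := by rw [ht]; exact Nat.le_mul_of_pos_left _ (by positivity)
  have ht16 : 16 ≤ t := hT₀16.trans hT₀t
  have h9t : 9 * t ≤ T := by
    have hp : 22 ^ j ≤ 22 ^ (J - 1) := Nat.pow_le_pow_right (by norm_num) (by omega)
    calc 9 * t = 9 * 22 ^ j * T₀ := by rw [ht]; ring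
      _ ≤ 9 * 22 ^ (J - 1) * T₀ := by gcongr
      _ = M * T₀ := by rw [hM]
      _ ≤ T := hMT₀
  have htpos : (0 : ℝ) < t := by exact_mod_cast (show 0 < t by omega)
  have hT₀t' : (T₀ : ℝ) ≤ t := by exact_mod_cast hT₀t
  set m₁ : ℕ := (t / 2 - 1) / 2 with hm₁
  have hm₁t : t ≤ 8 * m₁ := by omega
  have hm₁1 : 1 ≤ m₁ := by omega
  have hm₁T : m₁ < T := by omega
  have ham₁ : a m₁ ≤ A * u₀ := by
    refine (IH m₁ hm₁1 hm₁T).trans (mul_le_mul_of_nonneg_left (hcmp _ ?_) hApos.le)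
    linarith [(show (t : ℝ) ≤ 8 * (m₁ : ℝ) by exact_mod_cast hm₁t)]
  have hT₀16' : (16 : ℝ) ≤ T₀ := by exact_mod_cast hT₀16
  have hat1 : a (t - 1) ≤ A * u₀ := by
    refine (IH (t - 1) (by omega) (by omega)).trans (mul_le_mul_of_nonneg_left (hcmp _ ?_) hApos.le)
    have : ((t - 1 : ℕ) : ℝ) = (t : ℝ) - 1 := by push_cast [Nat.cast_sub (by omega : 1 ≤ t)]; ring
    rw [this]; linarith
  have haT₀1 : a (T₀ - 1) ≤ A * u₀ := by
    refine (IH (T₀ - 1) (by omega) (by omega)).trans (mul_le_mul_of_nonneg_left (hcmp _ ?_) hApos.le)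
    have : ((T₀ - 1 : ℕ) : ℝ) = (T₀ : ℝ) - 1 := by push_cast [Nat.cast_sub (by omega : 1 ≤ T₀)]; ring
    rw [this]; linarith
  have hS : ∀ n : ℕ, 1 ≤ n → n < T → (T₀ : ℝ) / 8 ≤ n →
      ∑ i ∈ range (n + 1), a i ≤ A * β * ((n : ℝ) * u₀) := by
    intro n hn1 hnT hn8
    have hnpos : (0 : ℝ) < n := by exact_mod_cast (show 0 < n by omega)
    set X : ℝ := (n : ℝ) ^ (1 - ε) with hX
    have hX1 : 1 ≤ X := Real.one_le_rpow (by exact_mod_cast hn1) h1ε.le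
    have hXle : X ≤ (n : ℝ) * u₀ := by
      rw [hX, sub_eq_add_neg, Real.rpow_add hnpos, Real.rpow_one]
      exact mul_le_mul_of_nonneg_left (hcmp _ hn8) hnpos.le
    rw [sum_range_succ']
    have h0 : a 0 ≤ A / 100 * X := by
      calc a 0 = A / 100 * 1 := by rw [hA]; ring
        _ ≤ A / 100 * X := mul_le_mul_of_nonneg_left hX1 (by positivity)
    have h1 : ∑ i ∈ range n, a (i + 1) ≤ A * (X / (1 - ε)) := by
      calc ∑ i ∈ range n, a (i + 1) ≤ ∑ i ∈ range n, A * (((i : ℝ) + 1) ^ (-ε)) := by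
            refine sum_le_sum fun i hi => ?_
            rw [mem_range] at hi
            have := IH (i + 1) (by omega) (by omega); push_cast at this; exact this
        _ = A * ∑ i ∈ range n, ((i : ℝ) + 1) ^ (-ε) := by rw [mul_sum]
        _ ≤ A * ((n : ℝ) ^ (1 - ε) / (1 - ε)) :=
            mul_le_mul_of_nonneg_left
              (Literature.Probability.RandomPlanarGeometry.KrachunPanagiotis.sum_rpow_neg_succ_le
                hε.le (by linarith) n) hApos.le
        _ = A * (X / (1 - ε)) := by rw [hX]
    calc ∑ i ∈ range n, a (i + 1) + a 0 ≤ A * (X / (1 - ε)) + A / 100 * X := add_le_add h1 h0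
      _ = A * β * X := by rw [hβ]; ring
      _ ≤ A * β * ((n : ℝ) * u₀) := mul_le_mul_of_nonneg_left hXle (by positivity)
  have e2 : ((2 * t : ℕ) : ℝ) = 2 * (t : ℝ) := by push_cast; ring
  have e5 : ((5 * t : ℕ) : ℝ) = 5 * (t : ℝ) := by push_cast; ring
  have h28 : (T₀ : ℝ) / 8 ≤ ((2 * t : ℕ) : ℝ) := by rw [e2]; linarith only [hT₀t', hT₀pos]
  have h58 : (T₀ : ℝ) / 8 ≤ ((5 * t : ℕ) : ℝ) := by rw [e5]; linarith only [hT₀t', hT₀pos]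
  have h2t1 : 1 ≤ 2 * t := by omega
  have h2tT : 2 * t < T := by omega
  have h5t1 : 1 ≤ 5 * t := by omega
  have h5tT : 5 * t < T := by omega
  have hS2 : ∑ i ∈ range (2 * t + 1), a i ≤ A * β * (2 * (t : ℝ) * u₀) := by
    have h := hS (2 * t) h2t1 h2tT h28; rwa [e2] at h
  have hS5 : ∑ i ∈ range (5 * t + 1), a i ≤ A * β * (5 * (t : ℝ) * u₀) := by
    have h := hS (5 * t) h5t1 h5tT h58; rwa [e5] at h
  have hS2pos : 0 < ∑ i ∈ range (2 * t + 1), a i := sum_pos (fun i _ => ha i) ⟨0, by simp⟩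
  have hS5pos : 0 < ∑ i ∈ range (5 * t + 1), a i := sum_pos (fun i _ => ha i) ⟨0, by simp⟩
  have hone2 : 1 ≤ (∑ i ∈ range (2 * t + 1), a i) / a 0 := by
    rw [le_div_iff₀ ha0, one_mul]
    exact single_le_sum (f := a) (fun i _ => (ha i).le) (mem_range.2 (by omega))
  have hone5 : 1 ≤ (∑ i ∈ range (5 * t + 1), a i) / a 0 := by
    rw [le_div_iff₀ ha0, one_mul]
    exact single_le_sum (f := a) (fun i _ => (ha i).le) (mem_range.2 (by omega))
  have hWt : W t ≤ κ * (A * u₀) / J := by refine hWj.trans ?_; gcongr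
  have hWt0 : 0 ≤ W t := hW t
  have ha2 := ha (2 * t)
  have ha5 := ha (5 * t)
  have hT9 : a T ≤ a (9 * t) := hanti h9t
  have hT5 : a T ≤ a (5 * t) := hanti h5tT.le
  have hT2 : a T ≤ a (2 * t) := hanti h2tT.le
  have haT := ha T
  by_cases hdrop1 : a (2 * t) < a m₁ / q
  · calc a T ≤ a (2 * t) := hT2
      _ ≤ a m₁ / q := hdrop1.le
      _ ≤ A * u₀ / q := div_le_div_of_nonneg_right ham₁ hqpos.le
      _ = A * (u₀ / q) := by ring
      _ ≤ A * u := mul_le_mul_of_nonneg_left hu₀qu hApos.le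
      _ = 100 * a 0 * (T : ℝ) ^ (-ε) := by rw [hA]
  by_cases hdrop2 : a (5 * t) < a (t - 1) / q
  · calc a T ≤ a (5 * t) := hT5
      _ ≤ a (t - 1) / q := hdrop2.le
      _ ≤ A * u₀ / q := div_le_div_of_nonneg_right hat1 hqpos.le
      _ = A * (u₀ / q) := by ring
      _ ≤ A * u := mul_le_mul_of_nonneg_left hu₀qu hApos.le
      _ = 100 * a 0 * (T : ℝ) ^ (-ε) := by rw [hA]
  have hdrop1' : a m₁ / q ≤ a (2 * t) := not_lt.1 hdrop1
  have hdrop2' : a (t - 1) / q ≤ a (5 * t) := not_lt.1 hdrop2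
  have hr1 : a m₁ / a (2 * t) ≤ q := by
    rw [div_le_iff₀ ha2]; rw [div_le_iff₀ hqpos] at hdrop1'; linarith only [hdrop1']
  have hr2 : a (t - 1) / a (5 * t) ≤ q := by
    rw [div_le_iff₀ ha5]; rw [div_le_iff₀ hqpos] at hdrop2'; linarith only [hdrop2']
  have hF₁ := cap_alg (B := A * β * (2 * (t : ℝ) * u₀)) hc₁ ha2 ha0 hS2pos hq1 hC₁ hr1 hone2 hS2
  have hF₂ := cap_alg (B := A * β * (5 * (t : ℝ) * u₀)) hc₁ ha5 ha0 hS5pos hq1 hC₁ hr2 hone5 hS5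
  have hF₂0 : 0 ≤ 1 + c₁ * a (t - 1) * (∑ i ∈ range (5 * t + 1), a i) / a (5 * t) :=
    add_nonneg zero_le_one (div_nonneg (mul_nonneg (mul_nonneg hc₁ (ha _).le) hS5pos.le) ha5.le)
  rcases hdich t (le_trans (by norm_num) ht16) with hA' | hB'
  · have := caseA_alg hca htpos haT ha2 hT2 hT5 hWt0 hApos hu₀pos hupos hqpos hC₁pos hβpos hκ hJpos
      hF₁ hWt hu₀ hcoefA hA'
    rw [hA] at this; exact this
  · have := caseB_alg hcb htpos haT ha2 ha5 hT2 hT5 hT9 hWt0 hF₂0 hApos hu₀pos hupos hqpos hC₁pos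
      hβpos hκ hJpos hF₁ hF₂ hWt hu₀ hcoefB hB'
    rw [hA] at this; exact this

end Summit.CriticalPhenomena.SAWScalingLimit.Theorems.HexConjecture.RootLocality.KPExplicit

end
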